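import Summits.Ventures.WeilGRH.TwoPrimeReflectionTransfer
import Summits.Ventures.WeilGRH.ReflectionInequalityAt
import HarnessLib

/-!
# GRH arm (rh-explicit, venture WeilGRH): the two-prime window with the prime `3` reflected

On the window `log 3 < 2a ≤ 2 log 2` (primes `2` and `3` inside) this file reverses the roles of
`TwoPrimeReflectionTransfer.lean`: the prime `3` is treated by the reflection `x ↦ log 3 − x` of the
folded window `[log 3 − a, a]` (`reflection_inequality_at` with `L = log 3`) and the prime `2` is paid
crudely out of a budget `δ₂ ≥ (log 2/√2)‖1 − χ(2)‖` charged on all of `‖g‖₂²`, through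

`2|k(L)| ≤ ‖g‖₂²` for `a ≤ L ≤ 2a` (`two_mul_norm_weilConv_weilReflect_le`: `k(L) = ∫_{L−a}^{a} g conj g(· − L)`,
`2|uv| ≤ |u|² + |v|²`, and `[L − a, a]`, `[−a, a − L]` are disjoint up to a point).

Since `2k₂' = √2·log 2 ≈ 0.98 < 2k₃' = 2 log 3/√3 ≈ 1.27`, this gives the better UNIFORM thresholds
(`TwoPrimeReflectionRungs`: all `χ` mod `q ≥ 36` at `59/100`, `q ≥ 70` at `log 2`; here `q ≥ 32`,
`q ≥ 50` — `ThirdPrimeReflectionRungs.lean`), and it is the natural route for characters with `χ(2) = 1`.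

## References

* A. Weil (1952), (11) and the «lemme» p. 262; H. Yoshida (1992) §6.
-/

noncomputable section

open Complex Filter Set MeasureTheory
open scoped Real Topology ComplexConjugate ArithmeticFunction.vonMangoldt

namespace Summit.Ventures.WeilGRH

open Literature.NumberTheory.LFunctions

variable {q : ℕ} {g : ℝ → ℂ}

/-- **`2|k(L)| ≤ ‖g‖₂²`** for `k = g ⋆ g̃`, `supp g ⊆ [-a, a]` and `a ≤ L ≤ 2a`: the integrand of
`k(L) = ∫ g(x) conj g(x − L) dx` lives on `[L − a, a]`, where `2|g(x)||g(x − L)| ≤ |g(x)|² + |g(x − L)|²`,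
and `∫_{L−a}^{a}|g|² + ∫_{−a}^{a−L}|g|² ≤ ‖g‖₂²` (`L − a ≥ 0 ≥ a − L`). [folklore] -/
theorem two_mul_norm_weilConv_weilReflect_le (hg : IsWeilTest g) {L a : ℝ}
    (hsupp : tsupport g ⊆ Icc (-a) a) (haL : a ≤ L) (hL2 : L ≤ 2 * a) :
    2 * ‖weilConv g (weilReflect g) L‖ ≤ ∫ x, ‖g x‖ ^ 2 := by
  set m : ℝ := L - a with hm
  have hm0 : 0 ≤ m := by rw [hm]; linarith
  have hma : m ≤ a := by rw [hm]; linarith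
  have hgc : Continuous g := hg.1.continuous
  have hz : ∀ x, x ∉ Icc (-a) a → g x = 0 := fun x hx ↦
    image_eq_zero_of_notMem_tsupport fun h ↦ hx (hsupp h)
  have hgL : Continuous fun x ↦ g (x - L) := hgc.comp (continuous_id.sub continuous_const)
  have hii2 : ∀ u v : ℝ, IntervalIntegrable (fun x ↦ ‖g x‖ ^ 2) volume u v :=
    fun u v ↦ (hgc.norm.pow 2).intervalIntegrable u v
  have hkint : weilConv g (weilReflect g) L = ∫ x in m..a, g x * conj (g (x - L)) := by
    rw [weilConv_weilReflect_apply_eq]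
    refine integral_eq_intervalIntegral_of_zero_off hma fun x hx ↦ ?_
    rw [mem_Icc, not_and_or, not_le, not_le] at hx
    rcases hx with hx | hx
    · have : g (x - L) = 0 := hz _ fun h ↦ by
        rw [mem_Icc] at h
        have : L - a = m := by rw [hm]
        linarith [h.1]
      simp [this]
    · have : g x = 0 := hz _ fun h ↦ by
        rw [mem_Icc] at h
        linarith [h.2]
      simp [this]
  have h1 : ‖weilConv g (weilReflect g) L‖ ≤ ∫ x in m..a, (‖g x‖ ^ 2 + ‖g (x - L)‖ ^ 2) / 2 := by
    rw [hkint]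
    refine (intervalIntegral.norm_integral_le_integral_norm hma).trans ?_
    refine intervalIntegral.integral_mono_on hma
      ((by fun_prop : Continuous fun x ↦ g x * conj (g (x - L))).norm.intervalIntegrable _ _)
      ((by fun_prop : Continuous fun x ↦
        (‖g x‖ ^ 2 + ‖g (x - L)‖ ^ 2) / 2).intervalIntegrable _ _) fun x _ ↦ ?_
    rw [norm_mul, Complex.norm_conj]
    have hsq := two_mul_le_add_sq ‖g x‖ ‖g (x - L)‖
    linarith only [hsq]
  have i3 : IntervalIntegrable (fun x ↦ ‖g (x - L)‖ ^ 2) volume m a :=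
    (hgL.norm.pow 2).intervalIntegrable _ _
  have h2 : ∫ x in m..a, (‖g x‖ ^ 2 + ‖g (x - L)‖ ^ 2) / 2 =
      ((∫ x in m..a, ‖g x‖ ^ 2) + ∫ x in (-a)..(-m), ‖g x‖ ^ 2) / 2 := by
    rw [intervalIntegral.integral_div, intervalIntegral.integral_add (hii2 _ _) i3,
      intervalIntegral.integral_comp_sub_right (fun x ↦ ‖g x‖ ^ 2) L,
      show m - L = -a by rw [hm]; ring, show a - L = -m by rw [hm]; ring]
  have hN : ∫ x, ‖g x‖ ^ 2 = (∫ x in (-a)..(-m), ‖g x‖ ^ 2) +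
      ((∫ x in (-m)..m, ‖g x‖ ^ 2) + ∫ x in m..a, ‖g x‖ ^ 2) := by
    rw [integral_eq_intervalIntegral_of_zero_off (lo := -a) (hi := a) (by linarith)
        (fun x hx ↦ by simp [hz x hx]),
      ← intervalIntegral.integral_add_adjacent_intervals (hii2 (-a) (-m)) (hii2 (-m) a),
      ← intervalIntegral.integral_add_adjacent_intervals (hii2 (-m) m) (hii2 m a)]
  have h0 : 0 ≤ ∫ x in (-m)..m, ‖g x‖ ^ 2 :=
    intervalIntegral.integral_nonneg (by linarith) fun x _ ↦ by positivity
  linarith only [h1, h2, hN, h0]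

/-- **REFLECTION TRANSFER WITH THE PRIME `3` REFLECTED.** Let `log 3 < 2a`, `a ≤ log 2`, `q ≠ 1`, `χ`
mod `q`, `u₃ = 1 − χ(3)`, `κ₃ = (log 3/√3)‖u₃‖`, `δ₂ ≥ (log 2/√2)‖1 − χ(2)‖`, `κ₃ + δ₂ < B ≤ log q`,
`B₃ = B − δ₂`, and `m = log 3 − a`, `C_M = sinh m + m`, `C_A = (sinh a − sinh m + a − m)/2`,
`I_A = (a − m)cosh((log 3)/2)/2 + sinh(a − (log 3)/2)`. If Weil positivity for `ζ` holds on `[-a, a]`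
and `2·[C_M (B₃² − κ₃²) + 2B₃ (B₃·C_A − (log 3/√3)·Re(u₃)·I_A)] ≤ B₃ (B₃² − κ₃²)`, then
`WeilPositivityOnChar χ a`. [cite: Weil1952FormulesExplicites, (11) and the «lemme» p. 262; Yoshida1992 §6] -/
theorem weilPositivityOnChar_transfer_reflection_third [NeZero q] {a : ℝ}
    (ha3 : Real.log 3 < 2 * a) (ha4 : a ≤ Real.log 2) (hζ : WeilPositivityOn a) (hq1 : q ≠ 1)
    (χ : DirichletCharacter ℂ q) {B κ δ : ℝ} (hBq : B ≤ Real.log q)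
    (hκ : κ = Real.log 3 / Real.sqrt 3 * ‖1 - χ (3 : ZMod q)‖)
    (hδ : Real.log 2 / Real.sqrt 2 * ‖1 - χ (2 : ZMod q)‖ ≤ δ) (hκB : κ + δ < B)
    {m CM CA IA : ℝ} (hm : m = Real.log 3 - a) (hCM : CM = Real.sinh m + m)
    (hCA : CA = (Real.sinh a - Real.sinh m + (a - m)) / 2)
    (hIA : IA = (a - m) * Real.cosh (Real.log 3 / 2) / 2 + Real.sinh (a - Real.log 3 / 2))
    (hcrit : 2 * (CM * ((B - δ) ^ 2 - κ ^ 2) +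
        2 * (B - δ) * ((B - δ) * CA - Real.log 3 / Real.sqrt 3 * (1 - χ (3 : ZMod q)).re * IA)) ≤
      (B - δ) * ((B - δ) ^ 2 - κ ^ 2)) :
    WeilPositivityOnChar χ a := by
  intro g hg hsupp
  set L₃ := Real.log 3 with hL₃
  set k₂ : ℝ := Real.log 2 / Real.sqrt 2 with hk₂
  set k₃ : ℝ := Real.log 3 / Real.sqrt 3 with hk₃
  set u : ℂ := 1 - χ (3 : ZMod q) with hu
  set u₂ : ℂ := 1 - χ (2 : ZMod q) with hu₂
  set r : ℝ := ‖u‖ with hr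
  have hk₂0 : 0 < k₂ := div_pos (Real.log_pos (by norm_num)) (by positivity)
  have hk₃0 : 0 < k₃ := div_pos (Real.log_pos (by norm_num)) (by positivity)
  have hr0 : 0 ≤ r := norm_nonneg _
  have hκ0 : 0 ≤ κ := by rw [hκ]; exact mul_nonneg hk₃0.le hr0
  have hδ0 : 0 ≤ δ := le_trans (mul_nonneg hk₂0.le (norm_nonneg _)) hδ
  set B₃ : ℝ := B - δ with hB₃
  have hκB₃ : κ < B₃ := by rw [hB₃]; linarith
  have hlog23 : Real.log 2 < Real.log 3 := Real.log_lt_log (by norm_num) (by norm_num)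
  -- the phase `ω` of `u = 1 − χ(3)`
  obtain ⟨ω, hω, huω⟩ : ∃ ω : ℂ, ‖ω‖ = 1 ∧ u = (r : ℂ) * ω := by
    by_cases hu0 : u = 0
    · exact ⟨1, by simp, by simp [hr, hu0]⟩
    · have hr' : r ≠ 0 := by rw [hr]; exact norm_ne_zero_iff.2 hu0
      refine ⟨u / (r : ℂ), ?_, ?_⟩
      · rw [norm_div, Complex.norm_real, Real.norm_eq_abs, abs_of_nonneg hr0, hr, div_self]
        exact norm_ne_zero_iff.2 hu0
      · rw [mul_div_cancel₀ _ (by exact_mod_cast hr')]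
  have hωre : (r : ℝ) * ω.re = u.re := by
    rw [huω, Complex.re_ofReal_mul]
  set kL₃ := weilConv g (weilReflect g) L₃ with hkL₃
  set kL₂ := weilConv g (weilReflect g) (Real.log 2) with hkL₂
  set N : ℝ := ∫ x, ‖g x‖ ^ 2 with hN
  set c : ℂ := ∫ x, g x * (Real.cosh (x / 2) : ℂ) with hc
  obtain ⟨hW0, hineq⟩ := reflection_inequality_at hg hsupp ha3 (ha4.trans hlog23.le) hω hκ0 hκB₃
    hm hCM hCA hIA
  set W : ℝ := B₃ * N + 2 * κ * (ω * kL₃).re with hW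
  set G : ℝ := CM / B₃ + (CA + ω.re * IA) / (B₃ + κ) + (CA - ω.re * IA) / (B₃ - κ) with hG
  have hB : 0 < B₃ := lt_of_le_of_lt hκ0 hκB₃
  have hBp : 0 < B₃ + κ := by linarith
  have hBm : 0 < B₃ - κ := by linarith
  have hκre : κ * ω.re = k₃ * u.re := by
    rw [hκ, ← hωre, hk₃, hr]; ring
  have hGB : G * (B₃ * ((B₃ + κ) * (B₃ - κ))) =
      CM * (B₃ ^ 2 - κ ^ 2) + 2 * B₃ * (B₃ * CA - k₃ * u.re * IA) := by
    rw [hG, ← hκre]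
    field_simp
    ring
  have h2G : 2 * G ≤ 1 := by
    have hpos : 0 < B₃ * ((B₃ + κ) * (B₃ - κ)) := by positivity
    refine le_of_mul_le_mul_right ?_ hpos
    calc 2 * G * (B₃ * ((B₃ + κ) * (B₃ - κ))) = 2 * (G * (B₃ * ((B₃ + κ) * (B₃ - κ)))) := by ring
      _ = 2 * (CM * (B₃ ^ 2 - κ ^ 2) + 2 * B₃ * (B₃ * CA - k₃ * u.re * IA)) := by rw [hGB]
      _ ≤ B₃ * (B₃ ^ 2 - κ ^ 2) := hcrit
      _ = 1 * (B₃ * ((B₃ + κ) * (B₃ - κ))) := by ring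
  have hc2 : 2 * ‖c‖ ^ 2 ≤ W := by
    have : ‖c‖ ^ 2 ≤ W * G := hineq
    nlinarith
  -- the corrections
  have hk : tsupport (weilConv g (weilReflect g)) ⊆ Icc (-(2 * Real.log 2)) (2 * Real.log 2) :=
    (tsupport_weilConv_weilReflect_subset hg.2 hsupp).trans (Icc_subset_Icc (by linarith) (by linarith))
  have hD := re_weilPrimeTerm_sub_weilPrimeTermChar_two χ hg hk
  have hDW : 2 * κ * (ω * kL₃).re = 2 * k₃ * (u * kL₃).re := by
    rw [huω, mul_assoc (r : ℂ), Complex.re_ofReal_mul, hκ, hk₃, hr]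
    ring
  -- the prime `2`, crudely: `2k₂ Re(u₂ k(log 2)) ≥ −δ N`
  have hN0 : 0 ≤ N := integral_nonneg fun t ↦ by positivity
  have hkN : 2 * ‖kL₂‖ ≤ N := two_mul_norm_weilConv_weilReflect_le hg hsupp ha4 (by linarith)
  have h2 : -(δ * N) ≤ 2 * k₂ * (u₂ * kL₂).re := by
    have h1 : |(u₂ * kL₂).re| ≤ ‖u₂‖ * ‖kL₂‖ := by
      rw [← norm_mul]; exact Complex.abs_re_le_norm _
    have h3 : k₂ * ‖u₂‖ * (2 * ‖kL₂‖) ≤ δ * N := mul_le_mul hδ hkN (by positivity) hδ0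
    have h4 := (abs_le.1 h1).1
    have h5 := mul_le_mul_of_nonneg_left h4 (by positivity : (0 : ℝ) ≤ 2 * k₂)
    linarith only [h3, h5]
  have hmain := re_weilQuadraticChar_ge hq1 χ hg
  have hζg : 0 ≤ (weilQuadratic g).re := hζ g hg hsupp
  have hP := two_mul_re_weilMellin_le hg
  have hNB : B * N ≤ N * Real.log q := by
    have h := mul_le_mul_of_nonneg_left hBq hN0
    rwa [mul_comm N B] at h
  rw [hD] at hmain
  rw [hW, hDW, hB₃] at hc2
  linarith

end Summit.Ventures.WeilGRH
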